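import Summits.NavierStokesRegularity.NavierStokesRegularity.Theorems.StrainDoorsScaledZoomForwardConst
import Literature.Analysis.FluidPDE.CurlFreeLiouville
import HarnessLib

/-!
# Strain doors, PART M §M32(c)–(d) — rigidity in `A_M` (small vorticity slice ⇒ small later `L³` mass) and
# the door Y∞ reduced to the door X

ROUND 71 of the `ns-regularity-ideate` p1 line (helper lane of `stmt-NavierStokesRegularity-0056`, rung N0;
nothing here is a claim about Navier–Stokes regularity — a-priori STRUCTURE of a HYPOTHETICAL singularity of a
solution which is Type I in the sup-norm; nothing about Type II).

PART M §M32 — door **Y∞**: at a singular point `(T,x₀)` of a classical Leray–Hopf solution with the global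
sup-norm Type-I bound `|u| ≤ M/√(T − t)`, for ALL `t` close to `T` the parabolic ball `B(x₀, R(M)√(T − t))`
contains a point with `(T − t)|ω(x,t)| ≥ d(M)` — constants depending on `M` ONLY (the quantitative, `M`-only,
every-time form of Barker–Prange 2020 (5.3), and the non-vacuity half of the `δ₀`-criterion of ROUNDS 68/70).
Mechanism: bad slices ⇒ zoom with the slice placed at `−4q²` (§M32(a)) ⇒ `U ∈ A_M` with small vorticity on a
large ball at `−4q²` AND — door X (ROUND 70, `M`-only every-time `L³` concentration) at the rescaled time `−2`
— definite `L³` mass at `−2` ⇒ second compactness in `A_M` ⇒ `W` with `curl W(−4q²) ≡ 0` ⇒ `W(−4q²) ≡ c`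
(curl-free Liouville) ⇒ LEMMA F (§M32(b), forward uniqueness of a constant slice in `A_M`) `W(−2) ≡ c`,
`|c| ≤ M/(2q)` ⇒ mass `|c|³·|B̄| < γ(M)` for `q = q(M)`: contradiction (§M32(c)–(d)).

THIS FILE (text N12b): §M32(c) `smallCurlSlice_forces_smallMass` (for `M, R_m, γ > 0`: `q(M,R_m,γ) ≥ 1`,
`ρ, η > 0` with: `U ∈ A_M`, `|curl U(−4q²)| ≤ η` on `B(0,ρ)` ⇒ `∫_{B̄(0,R_m√2)}|U(−2)|³ < γ`; second
compactness `typeIAncientCompactness_holds` + curl-free Liouville + LEMMA F); §M32(d) the typed door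
`SliceVorticityFloorSupTypeI` (Y∞) and `sliceVorticityFloorSupTypeI_of_sliceL3Concentration : SliceL3Concentration →
SliceVorticityFloorSupTypeI`.  One definition (`SliceVorticityFloorSupTypeI`, a parameterless `Prop`, no cite tag).
No `sorry`, no new axioms.
-/

noncomputable section
set_option linter.dupNamespace false
open MeasureTheory Set Function Filter Metric Real InnerProductSpace
open _root_.Topology
open scoped ENNReal NNReal RealInnerProductSpace ContDiff
open Literature.Analysis Literature.Analysis.FluidPDE Literature.Analysis.FluidPDE.LocalTypeIBlowup

namespace Summit.NavierStokesRegularity.NavierStokesRegularity.Theorems.StrainDoors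

/-! ### §M32(c) In `A_M`: a slice with small vorticity on a large ball cannot be followed by a slice
### with definite `L³` mass -/

/-- ★★★ **RIGIDITY IN `A_M` (second compactness): SMALL VORTICITY AT `−4q²` ON A LARGE BALL FORCES SMALL
`L³` MASS AT `−2`.**  For `M`, `R_m`, `γ > 0` there are `q = q(M,R_m,γ) ≥ 1` and `ρ, η > 0` (depending on
`M, R_m, γ` only) such that every `U ∈ A_M` with `|curl U(−4q²)| ≤ η` on `B(0,ρ)` has
`∫_{B̄(0, R_m√2)} |U(−2)|³ < γ`.  Proof: `q` is chosen first with `(M/(2q))³ · |B̄(0,R_m√2)| < γ`; if no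
`(ρ, η)` works, members `U_j ∈ A_M` with `|curl U_j(−4q²)| ≤ 1/(j+1)` on `B(0,j+1)` and mass `≥ γ` at `−2`
converge along a subsequence (the compactness of `A_M` WITH vorticities, (P2) of ROUND 66,
`typeIAncientCompactness_holds`) to `W ∈ A_M` with `curl W(−4q²) ≡ 0` and (dominated convergence,
`|U_j(−2)| ≤ M/√2`) mass `≥ γ` at `−2`; the curl-free, divergence-free, bounded slice `W(−4q²)` is a constant
`c` (`eq_of_curl_eq_zero_of_isDivFree_of_bounded`, KNSS Lemma 3.1), `|c| ≤ M/(2q)` by the Type-I rate, the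
constant slice propagates forward (`typeIAncientMild_forward_const`): `W(−2) ≡ c`, so the mass at `−2` is
`|c|³ |B̄(0,R_m√2)| < γ` — a contradiction.
[cite: KochNadirashviliSereginSverak2009, Lemma 3.1 and Remark 6.1 (arXiv:0709.3599); BarkerPrange2020Alignment, §4 Step 5 (arXiv:1906.08225 p. 17)] -/
theorem smallCurlSlice_forces_smallMass (M Rm : ℝ) {γ : ℝ} (hγ : 0 < γ) :
    ∃ q : ℝ, 1 ≤ q ∧ ∃ ρ η : ℝ, 0 < ρ ∧ 0 < η ∧
      ∀ U : ℝ → EuclideanSpace ℝ (Fin 3) → EuclideanSpace ℝ (Fin 3), IsTypeIAncientMild M U →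
        (∀ y ∈ ball (0 : EuclideanSpace ℝ (Fin 3)) ρ, ‖curl (U (-(4 * q ^ 2))) y‖ ≤ η) →
        ∫ y in closedBall (0 : EuclideanSpace ℝ (Fin 3)) (Rm * Real.sqrt 2), ‖U (-2) y‖ ^ 3 < γ := by
  -- the volume of the mass ball and the choice of `q`
  set V : ℝ := (volume (closedBall (0 : EuclideanSpace ℝ (Fin 3)) (Rm * Real.sqrt 2))).toReal with hVdef
  have hV0 : 0 ≤ V := ENNReal.toReal_nonneg
  set A : ℝ := max M 0 with hAdef
  have hA0 : 0 ≤ A := le_max_right _ _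
  have hMA : M ≤ A := le_max_left _ _
  set q : ℝ := A ^ 3 * V / γ + 1 with hqdef
  have hq1 : 1 ≤ q := by
    rw [hqdef]
    have : 0 ≤ A ^ 3 * V / γ := by positivity
    linarith
  have hq0 : 0 < q := lt_of_lt_of_le one_pos hq1
  have hsmall : (A / (2 * q)) ^ 3 * V < γ := by
    have h1 : (A / (2 * q)) ^ 3 * V = A ^ 3 * V / (8 * q ^ 3) := by
      field_simp
      ring
    rw [h1, div_lt_iff₀ (by positivity)]
    have h2 : A ^ 3 * V < γ * q := by
      rw [hqdef, mul_add, mul_div_cancel₀ _ hγ.ne', mul_one]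
      linarith
    have h3 : γ * q ≤ γ * (8 * q ^ 3) := by
      apply mul_le_mul_of_nonneg_left _ hγ.le
      nlinarith [hq1, sq_nonneg q, mul_pos hq0 hq0]
    linarith
  refine ⟨q, hq1, ?_⟩
  have hσ₁ : -(4 * q ^ 2) < 0 := by nlinarith [hq0]
  have hσ₁2 : -(4 * q ^ 2) ≤ -2 := by nlinarith [hq1]
  have h2 : (-2 : ℝ) < 0 := by norm_num
  by_contra hneg
  push Not at hneg
  have hF := fun j : ℕ => hneg ((j : ℝ) + 1) (1 / ((j : ℝ) + 1)) (by positivity) (by positivity)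
  choose U hUA hcurl hmass using hF
  -- (1) compactness in `A_M` with vorticities
  obtain ⟨W, φ, hφ, hW, hlim⟩ := typeIAncientCompactness_holds M U hUA
  -- (2) the limit slice at `−4q²` is curl free
  have hcurlW : ∀ y : EuclideanSpace ℝ (Fin 3), curl (W (-(4 * q ^ 2))) y = 0 := by
    intro y
    have hT := (hlim _ hσ₁ y).2
    have hzero : Tendsto (fun j => curl (U (φ j) (-(4 * q ^ 2))) y) atTop (𝓝 0) := by
      have hb : Tendsto (fun j : ℕ => 1 / ((φ j : ℝ) + 1)) atTop (𝓝 0) :=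
        (tendsto_one_div_add_atTop_nhds_zero_nat (𝕜 := ℝ)).comp hφ.tendsto_atTop
      refine squeeze_zero_norm' ?_ hb
      obtain ⟨N, hN⟩ := exists_nat_ge ‖y‖
      refine eventually_atTop.2 ⟨N, fun j hj => ?_⟩
      have hyb : y ∈ ball (0 : EuclideanSpace ℝ (Fin 3)) ((φ j : ℝ) + 1) := by
        rw [mem_ball_zero_iff]
        have h1 : (N : ℝ) ≤ φ j := by exact_mod_cast hj.trans (hφ.id_le j)
        linarith
      exact hcurl (φ j) y hyb
    exact tendsto_nhds_unique hT hzero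
  -- (3) the limit slice at `−2` has mass `≥ γ`
  have hmassW : γ ≤ ∫ y in closedBall (0 : EuclideanSpace ℝ (Fin 3)) (Rm * Real.sqrt 2), ‖W (-2) y‖ ^ 3 := by
    have hfin : IsFiniteMeasure (volume.restrict (closedBall (0 : EuclideanSpace ℝ (Fin 3)) (Rm * Real.sqrt 2))) :=
      isFiniteMeasure_restrict.2 measure_closedBall_lt_top.ne
    have hT' : Tendsto (fun j => ∫ y in closedBall (0 : EuclideanSpace ℝ (Fin 3)) (Rm * Real.sqrt 2),
        ‖U (φ j) (-2) y‖ ^ 3)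
        atTop (𝓝 (∫ y in closedBall (0 : EuclideanSpace ℝ (Fin 3)) (Rm * Real.sqrt 2), ‖W (-2) y‖ ^ 3)) := by
      refine tendsto_integral_of_dominated_convergence (fun _ => (M / Real.sqrt 2) ^ 3)
        (fun j => (((hUA (φ j)).continuous_slice h2).norm.pow 3).aestronglyMeasurable) (integrable_const _) ?_ ?_
      · intro j
        refine Eventually.of_forall fun y => ?_
        rw [Real.norm_of_nonneg (pow_nonneg (norm_nonneg _) 3)]
        have hb := (hUA (φ j)).norm_le h2 y
        rw [neg_neg] at hb
        exact pow_le_pow_left₀ (norm_nonneg _) hb 3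
      · exact Eventually.of_forall fun y => ((hlim _ h2 y).1.norm).pow 3
    exact ge_of_tendsto hT' (Eventually.of_forall fun j => hmass (φ j))
  -- (4) Liouville on the slice `−4q²`: `W(−4q²) ≡ c`, `|c| ≤ M/(2q)`
  have hconst : ∀ x : EuclideanSpace ℝ (Fin 3), W (-(4 * q ^ 2)) x = W (-(4 * q ^ 2)) 0 := fun x =>
    eq_of_curl_eq_zero_of_isDivFree_of_bounded ((hW.contDiff_slice hσ₁).of_le (by norm_cast))
      hcurlW (hW.isDivFree hσ₁) (fun z => hW.norm_le hσ₁ z) x 0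
  have hcb : ‖W (-(4 * q ^ 2)) 0‖ ≤ A / (2 * q) := by
    have h := hW.norm_le hσ₁ (0 : EuclideanSpace ℝ (Fin 3))
    have hsq : Real.sqrt (-(-(4 * q ^ 2))) = 2 * q := by
      rw [neg_neg, show (4 : ℝ) * q ^ 2 = (2 * q) ^ 2 by ring, Real.sqrt_sq (by positivity)]
    rw [hsq] at h
    exact h.trans (div_le_div_of_nonneg_right hMA (by positivity))
  -- (5) forward propagation to the slice `−2` and the contradiction
  have hW2 : ∀ y : EuclideanSpace ℝ (Fin 3), W (-2) y = W (-(4 * q ^ 2)) 0 := fun y =>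
    typeIAncientMild_forward_const hW hconst hσ₁2 h2 y
  have hmass_eq : ∫ y in closedBall (0 : EuclideanSpace ℝ (Fin 3)) (Rm * Real.sqrt 2), ‖W (-2) y‖ ^ 3 =
      V * ‖W (-(4 * q ^ 2)) 0‖ ^ 3 := by
    simp_rw [hW2]
    rw [setIntegral_const, smul_eq_mul, hVdef, Measure.real]
  have hle : V * ‖W (-(4 * q ^ 2)) 0‖ ^ 3 ≤ (A / (2 * q)) ^ 3 * V := by
    rw [mul_comm]
    exact mul_le_mul_of_nonneg_right (pow_le_pow_left₀ (norm_nonneg _) hcb 3) hV0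
  linarith

/-! ### §M32(d) Door Y∞ — the `M`-only similarity-scale vorticity floor at sup-Type-I singular points -/

/-- ★ door **Y∞** («SIMILARITY-SCALE VORTICITY FLOOR UNDER THE SUP-NORM TYPE-I RATE»; typed AND proved in
ROUND 71, `sliceVorticityFloorSupTypeI_holds`).  For every `M` there are `R = R(M) > 0` and `d = d(M) > 0`,
depending on `M` ONLY, such that: if `(u,p)` is a classical solution of the unit-viscosity unforced
Navier–Stokes system on `ℝ³ × [0,T)`, Leray–Hopf on `[0,T)`, with the global sup-norm Type-I bound
`|u(x,t)| ≤ M/√(T − t)`, and `(T,x₀)` is a (backward) singular point, then for ALL times `t < T` close to `T`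
the parabolic ball `B(x₀, R√(T − t))` contains a point with `(T − t)|ω(x,t)| ≥ d` — equivalently, the
superlevel set `{|ω(·,t)| ≥ d/(T − t)}` of the vorticity meets `B(x₀, R√(T − t))` at every time near the
blow-up time.  This is the quantitative, `M`-only, EVERY-TIME form of the concentration of vorticity at
Type-I singular points (Barker–Prange 2020, (5.3): `Ω_d ∩ B(x₀, R√(T − t_n)) ≠ ∅` along the blow-up
sequence, with constants depending on the solution), i.e. the NON-VACUITY half of the `δ₀`-criterion of
ROUNDS 68/70 (`sliceAligned_fixedDelta_not_singular_of_supTypeI_M_only`): inside `B(x₀,R√(T−s_n))` the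
threshold set `{|ω(·,s_n)| > d'}` is non-empty for every FIXED `d'` once `d/(T − s_n) > d'`.
What is known: (1) for ONE solution, `Ω_d ∩ B(x₀, R√(T − t_n)) ≠ ∅` along the blow-up sequence with
`d, R` depending on `(M, u)` is Barker–Prange's (5.3) (arXiv:1906.08225, proof of Thm 1, Step 4: zoom + KNSS
Liouville theorem); (2) under the Type-I bound in the LORENTZ form `‖u‖_{L^∞_t L^{3,∞}_x} ≤ M₃` the EVERY-TIME
local ENSTROPHY floor `∫_{B(x₀, 4 S♯(M₃)^{-1/2} √(T−t))} |ω(t)|² > M₃² √S♯(M₃) (T − t)^{-1/2}` at a singular point,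
with `M₃`-only constants, is implicit in Barker–Prange 2021 (CMP 385, §1.3, arXiv:2003.06717 p. 6: the
contrapositive of the Jia–Šverák local-smoothing step), and by averaging over the ball it yields a point with
`(T − t)|ω| ≥ d(M₃)`; Tao 2021 (arXiv:1908.04958 p. 37) has such floors on `epochs of regularity` under
`L^∞_t L³_x ≤ A`; (3) the `L²`-version under the MORREY-type bound `M_*` is Kang–Miura–Tsai 2021, Thm 1.6(ii);
(4) the global floor `‖∇u(t)‖_∞ ≥ c/(T − t)` at any blow-up is Leray 1934 (3.16).  New as typed: the hypothesis
is the SUP-NORM rate `|u| ≤ M/√(T − t)` (which bounds neither `‖u(t)‖_{L^{3,∞}}` nor `M_*` in terms of `M`) and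
the constants depend on `M` ONLY, at EVERY time near `T`, LOCALISED to the parabolic balls at the singular
point; the proof below is Carleman-free and local-smoothing-free (compactness + Liouville + forward uniqueness
in `A_M`, fed by door X of ROUND 70).  Why it might have failed: an `M`-only `(R, d)` is a uniform statement over
the whole sup-norm Type-I class (same flavour as door X).  Sources (in prose on purpose — a parameterless typed
door must not carry a cite tag): Barker–Prange 2020 (arXiv:1906.08225) Thm 1, §4 and (5.3); Barker–Prange 2021
(CMP 385) §1.3; Kang–Miura–Tsai 2021 (PAA 3) Thm 1.6; Tao 2021, §6; Koch–Nadirashvili–Seregin–Šverák 2009,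
Remark 6.1; Leray 1934 (3.16).  [new-as-typed] -/
def SliceVorticityFloorSupTypeI : Prop :=
  ∀ M : ℝ, ∃ R d : ℝ, 0 < R ∧ 0 < d ∧
    ∀ (T : ℝ) (u : ℝ → EuclideanSpace ℝ (Fin 3) → EuclideanSpace ℝ (Fin 3))
      (p : ℝ → EuclideanSpace ℝ (Fin 3) → ℝ), 0 < T →
      IsClassicalNSSolutionOn (Ico 0 T) 1 0 u p → IsLerayHopfOn T 1 0 (u 0) u →
      (∀ t ∈ Ioo 0 T, ∀ x : EuclideanSpace ℝ (Fin 3), ‖u t x‖ ≤ M / Real.sqrt (T - t)) →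
      ∀ x₀ : EuclideanSpace ℝ (Fin 3), IsBackwardSingularPoint u (T, x₀) →
        ∃ t₁ : ℝ, t₁ < T ∧ ∀ t ∈ Ioo t₁ T,
          ∃ x ∈ ball x₀ (R * Real.sqrt (T - t)), d ≤ (T - t) * ‖curl (u t) x‖

/-- ★★★★ **DOOR Y∞ FROM DOOR X: THE `M`-ONLY SIMILARITY-SCALE VORTICITY FLOOR AT SUP-TYPE-I SINGULAR
POINTS, REDUCED TO EVERY-TIME `L³` CONCENTRATION.**  `SliceL3Concentration → SliceVorticityFloorSupTypeI`, with
`R(M) = ρ` and `d(M) = η` of `smallCurlSlice_forces_smallMass` at `(M, R_m(M), γ(M))` of the door X (door X is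
CLOSED in ROUND 70, `sliceL3Concentration_holds`; the unconditional door Y∞ is `sliceVorticityFloorSupTypeI_holds`
in `StrainDoorsDoorYClosed`).  Proof: if along times `s_n → T`
the scaled vorticity `(T − s_n)|ω(·,s_n)|` stays `< η` on `B(x₀, ρ√(T − s_n))`, zoom at `(T,x₀)` with the
slice `s_n` placed at the rescaled time `−4q²` (`exists_zoomLimit_at_singular_along_scaled`): the limit
`U ∈ A_M` has `|curl U(−4q²)| ≤ η` on `B(0,ρ)` (pointwise limit of the rescaled vorticities), while the door X
at the times `T − (T − s_n)/(2q²) → T` — the rescaled time `−2` — gives, by scale invariance of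
`∫_{B̄(x₀,R_m√(T−t))}|u(t)|³` and dominated convergence (`|zoom| ≤ M/√2`), `∫_{B̄(0,R_m√2)}|U(−2)|³ ≥ γ`;
this contradicts `smallCurlSlice_forces_smallMass`.  (Nearest print: the every-time local ENSTROPHY floor
under the `L^{3,∞}` Type-I bound, Barker–Prange 2021 §1.3 p. 6, by Jia–Šverák local smoothing; here: sup-norm
rate, `M`-only constants, no local smoothing / Carleman input.)
[cite: BarkerPrange2020Alignment, §4 Steps 1–5 (arXiv:1906.08225 pp. 16–17); BarkerPrange2021, §1.3
(arXiv:2003.06717 p. 6); BarkerPrange2020, Thm 2; KochNadirashviliSereginSverak2009, Lemma 3.1 and Remark 6.1] -/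
theorem sliceVorticityFloorSupTypeI_of_sliceL3Concentration (hX : SliceL3Concentration) :
    SliceVorticityFloorSupTypeI := by
  intro M
  obtain ⟨γ, Rm, hγ, hRm, hXM⟩ := hX M
  obtain ⟨q, hq1, ρ, η, hρ, hη, hrig⟩ := smallCurlSlice_forces_smallMass M Rm hγ
  refine ⟨ρ, η, hρ, hη, ?_⟩
  intro T u p hT hcl hLH hI x₀ hsing
  obtain ⟨t₁, ht₁, hmass⟩ := hXM T u p hT hcl hLH hI x₀ hsing
  have hq0 : 0 < q := lt_of_lt_of_le one_pos hq1
  have hσ₁ : -(4 * q ^ 2) < -1 := by nlinarith [hq1]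
  have h2 : (-2 : ℝ) < -1 := by norm_num
  have h20 : (-2 : ℝ) < 0 := by norm_num
  by_contra hbad
  push Not at hbad
  -- (1) a sequence of bad slices `s n → T`
  have hF := fun n : ℕ => hbad (T - T * (1 / ((n : ℝ) + 1)))
    (by have : 0 < T * (1 / ((n : ℝ) + 1)) := by positivity
        linarith)
  choose s hs hsc using hF
  have hs0 : ∀ n, s n ∈ Ioo 0 T := by
    intro n
    refine ⟨?_, (hs n).2⟩
    have h1 : T * (1 / ((n : ℝ) + 1)) ≤ T := by
      have : 1 / ((n : ℝ) + 1) ≤ 1 := by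
        rw [div_le_one (by positivity)]
        linarith [(n.cast_nonneg : (0 : ℝ) ≤ n)]
      nlinarith
    linarith [(hs n).1]
  have hsT : Tendsto s atTop (𝓝 T) := by
    have hlow : Tendsto (fun n : ℕ => T - T * (1 / ((n : ℝ) + 1))) atTop (𝓝 T) := by
      have h := ((tendsto_one_div_add_atTop_nhds_zero_nat (𝕜 := ℝ)).const_mul T).const_sub T
      rwa [mul_zero, sub_zero] at h
    exact tendsto_of_tendsto_of_tendsto_of_le_of_le hlow tendsto_const_nhds
      (fun n => (hs n).1.le) (fun n => (hs n).2.le)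
  -- a tail beyond `t₁`
  obtain ⟨N, hN⟩ : ∃ N : ℕ, ∀ n ≥ N, t₁ < s n :=
    eventually_atTop.1 (hsT.eventually (Ioi_mem_nhds ht₁))
  set s' : ℕ → ℝ := fun n => s (n + N) with hs'def
  have hs' : ∀ n, s' n ∈ Ioo 0 T := fun n => hs0 (n + N)
  have hs'T : Tendsto s' atTop (𝓝 T) := hsT.comp (tendsto_add_atTop_nat N)
  have hs't₁ : ∀ n, t₁ < s' n := fun n => hN (n + N) (Nat.le_add_left N n)
  have hsc' : ∀ n, ∀ x ∈ ball x₀ (ρ * Real.sqrt (T - s' n)), (T - s' n) * ‖curl (u (s' n)) x‖ < η :=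
    fun n => hsc (n + N)
  -- (2) zoom along `s'` with the slice at `−4q²`
  obtain ⟨φ, hφ, U, hU, hvel, hcurl⟩ :=
    exists_zoomLimit_at_singular_along_scaled hT hcl hLH hI hsing hs' hs'T hq1
  set lam : ℕ → ℝ := fun j => Real.sqrt (T - s' (φ j)) / (2 * q) with hlamdef
  have hTs : ∀ j, 0 < T - s' (φ j) := fun j => by linarith [(hs' (φ j)).2]
  have hlam : ∀ j, 0 < lam j := fun j => by rw [hlamdef]; exact div_pos (Real.sqrt_pos.2 (hTs j)) (by positivity)
  have hlam2 : ∀ j, lam j ^ 2 = (T - s' (φ j)) / (4 * q ^ 2) := fun j => by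
    rw [hlamdef]
    dsimp only
    rw [div_pow, Real.sq_sqrt (hTs j).le]
    ring
  have e_slice : ∀ j, T + lam j ^ 2 * (-(4 * q ^ 2)) = s' (φ j) := fun j => by
    rw [hlam2]
    field_simp
    ring
  have hlam_le : ∀ j, lam j ≤ Real.sqrt (T - s' (φ j)) := fun j => by
    rw [hlamdef]
    dsimp only
    rw [div_le_iff₀ (by positivity)]
    have := Real.sqrt_nonneg (T - s' (φ j))
    nlinarith
  -- (3) the limit slice at `−4q²` has vorticity `≤ η` on `B(0,ρ)`
  have hcurlU : ∀ y ∈ ball (0 : EuclideanSpace ℝ (Fin 3)) ρ, ‖curl (U (-(4 * q ^ 2))) y‖ ≤ η := by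
    intro y hy
    have hyρ : ‖y‖ < ρ := mem_ball_zero_iff.1 hy
    have h := (hcurl _ hσ₁ y).norm
    refine le_of_tendsto' h fun j => ?_
    show ‖lam j ^ 2 • curl (u (T + lam j ^ 2 * (-(4 * q ^ 2)))) (x₀ + lam j • y)‖ ≤ η
    rw [e_slice j]
    have hmem : x₀ + lam j • y ∈ ball x₀ (ρ * Real.sqrt (T - s' (φ j))) := by
      rw [mem_ball, dist_eq_norm, add_sub_cancel_left, norm_smul, Real.norm_of_nonneg (hlam j).le]
      calc lam j * ‖y‖ < lam j * ρ := mul_lt_mul_of_pos_left hyρ (hlam j)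
        _ ≤ Real.sqrt (T - s' (φ j)) * ρ := mul_le_mul_of_nonneg_right (hlam_le j) hρ.le
        _ = ρ * Real.sqrt (T - s' (φ j)) := mul_comm _ _
    have hlt := hsc' (φ j) _ hmem
    have hq4 : 1 ≤ 4 * q ^ 2 := by nlinarith [hq1]
    have hnn : 0 ≤ (T - s' (φ j)) * ‖curl (u (s' (φ j))) (x₀ + lam j • y)‖ :=
      mul_nonneg (hTs j).le (norm_nonneg _)
    rw [norm_smul, Real.norm_of_nonneg (sq_nonneg _), hlam2]
    calc (T - s' (φ j)) / (4 * q ^ 2) * ‖curl (u (s' (φ j))) (x₀ + lam j • y)‖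
        = (T - s' (φ j)) * ‖curl (u (s' (φ j))) (x₀ + lam j • y)‖ / (4 * q ^ 2) := by ring
      _ ≤ (T - s' (φ j)) * ‖curl (u (s' (φ j))) (x₀ + lam j • y)‖ := div_le_self hnn hq4
      _ ≤ η := hlt.le
  -- (4) the limit slice at `−2` has mass `≥ γ` (door X at the times `T − 2λ_j²`)
  have hM0 : 0 ≤ M := by
    have h := hI _ (hs' 0) x₀
    have hsq : 0 < Real.sqrt (T - s' 0) := Real.sqrt_pos.2 (by linarith [(hs' 0).2])
    have := (norm_nonneg _).trans h
    exact (div_nonneg_iff.1 this).elim (fun h => h.1) fun h => by linarith [h.2]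
  have hτT : ∀ j, T + lam j ^ 2 * (-2) < T := fun j => by nlinarith [hlam j]
  have hτs : ∀ j, s' (φ j) < T + lam j ^ 2 * (-2) := fun j => by
    rw [hlam2]
    have h4 : (T - s' (φ j)) / (4 * q ^ 2) ≤ (T - s' (φ j)) / 4 :=
      div_le_div_of_nonneg_left (hTs j).le (by norm_num) (by nlinarith [hq1])
    linarith [hTs j]
  have hτ0 : ∀ j, 0 < T + lam j ^ 2 * (-2) := fun j => (hs' (φ j)).1.trans (hτs j)
  have e_sqrt : ∀ j, Real.sqrt (T - (T + lam j ^ 2 * (-2))) = Real.sqrt 2 * lam j := fun j => by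
    rw [show T - (T + lam j ^ 2 * (-2)) = 2 * lam j ^ 2 by ring, Real.sqrt_mul (by norm_num : (0 : ℝ) ≤ 2),
      Real.sqrt_sq (hlam j).le]
  have hslice : ∀ j, Continuous (u (T + lam j ^ 2 * (-2))) := by
    intro j
    have hc : ContinuousOn (uncurry u) (Ico 0 T ×ˢ univ) := hcl.smooth_velocity.continuousOn
    exact hc.comp_continuous (continuous_const.prodMk continuous_id)
      (fun x : EuclideanSpace ℝ (Fin 3) => (⟨⟨(hτ0 j).le, hτT j⟩, mem_univ x⟩ :
        (T + lam j ^ 2 * (-2), x) ∈ Ico 0 T ×ˢ univ))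
  have hzc : ∀ j, Continuous (fun y : EuclideanSpace ℝ (Fin 3) =>
      lam j • u (T + lam j ^ 2 * (-2)) (x₀ + lam j • y)) := by
    intro j
    have h1 : Continuous (fun y : EuclideanSpace ℝ (Fin 3) => x₀ + lam j • id y) :=
      continuous_const.add (continuous_id.const_smul (lam j))
    exact ((hslice j).comp h1).const_smul (lam j)
  have hzb : ∀ j (y : EuclideanSpace ℝ (Fin 3)), ‖lam j • u (T + lam j ^ 2 * (-2)) (x₀ + lam j • y)‖ ≤
      M / Real.sqrt 2 := by
    intro j y
    have h := hI _ ⟨hτ0 j, hτT j⟩ (x₀ + lam j • y)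
    rw [e_sqrt j, le_div_iff₀ (mul_pos (Real.sqrt_pos.2 (by norm_num)) (hlam j))] at h
    rw [norm_smul, Real.norm_of_nonneg (hlam j).le, le_div_iff₀ (by positivity)]
    calc lam j * ‖u (T + lam j ^ 2 * (-2)) (x₀ + lam j • y)‖ * Real.sqrt 2
        = ‖u (T + lam j ^ 2 * (-2)) (x₀ + lam j • y)‖ * (Real.sqrt 2 * lam j) := by ring
      _ ≤ M := h
  have hzmass : ∀ j, γ ≤ ∫ y in closedBall (0 : EuclideanSpace ℝ (Fin 3)) (Rm * Real.sqrt 2),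
      ‖lam j • u (T + lam j ^ 2 * (-2)) (x₀ + lam j • y)‖ ^ 3 := by
    intro j
    rw [setIntegral_norm_zoom_pow_three (u (T + lam j ^ 2 * (-2))) x₀ (hlam j) (by positivity)]
    have e : lam j * (Rm * Real.sqrt 2) = Rm * Real.sqrt (T - (T + lam j ^ 2 * (-2))) := by
      rw [e_sqrt j]; ring
    rw [e]
    exact hmass _ ⟨(hs't₁ (φ j)).trans (hτs j), hτT j⟩
  have hmassU : γ ≤ ∫ y in closedBall (0 : EuclideanSpace ℝ (Fin 3)) (Rm * Real.sqrt 2), ‖U (-2) y‖ ^ 3 := by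
    have hfin : IsFiniteMeasure (volume.restrict (closedBall (0 : EuclideanSpace ℝ (Fin 3)) (Rm * Real.sqrt 2))) :=
      isFiniteMeasure_restrict.2 measure_closedBall_lt_top.ne
    have hT' : Tendsto (fun j => ∫ y in closedBall (0 : EuclideanSpace ℝ (Fin 3)) (Rm * Real.sqrt 2),
        ‖lam j • u (T + lam j ^ 2 * (-2)) (x₀ + lam j • y)‖ ^ 3)
        atTop (𝓝 (∫ y in closedBall (0 : EuclideanSpace ℝ (Fin 3)) (Rm * Real.sqrt 2), ‖U (-2) y‖ ^ 3)) := by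
      refine tendsto_integral_of_dominated_convergence (fun _ => (M / Real.sqrt 2) ^ 3)
        (fun j => ((hzc j).norm.pow 3).aestronglyMeasurable) (integrable_const _) ?_ ?_
      · intro j
        refine Eventually.of_forall fun y => ?_
        rw [Real.norm_of_nonneg (pow_nonneg (norm_nonneg _) 3)]
        exact pow_le_pow_left₀ (norm_nonneg _) (hzb j y) 3
      · refine Eventually.of_forall fun y => ?_
        have h := hvel (-2) h2 y
        exact (h.norm).pow 3
    exact ge_of_tendsto hT' (Eventually.of_forall hzmass)
  -- (5) contradiction with the rigidity in `A_M`
  have hlt := hrig U hU hcurlU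
  linarith


end Summit.NavierStokesRegularity.NavierStokesRegularity.Theorems.StrainDoors

end
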